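import Summits.Schanuel.Schanuel.Theorems.ZilberEacGraphBinomialSurface
import HarnessLib

/-!
# The equimodular class, XX: examples of binomial fibres — `{x₁ = c·x₀^d, x₀ y₀^r = x₀ + 1}`

HONEST FRAMING.  Cell `pub-schanuel` (Zilber's Exponential-Algebraic Closedness, case ladder;
host summit Schanuel), seat 2, gen 23.  Instances of file XIX
(`unprojectedDense_graphBinomialSurface`): for every `d ≥ 2`, `r ≥ 1`, `c ≠ 0` the surface
`{x₁ = c·x₀^d, x₀ y₀^r = x₀ + 1}` — `r`-th roots `y₀ = (1 + 1/x₀)^{1/r}`, all top-row roots on the unit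
circle — is in Mantova–Masser's case and has Zariski-dense exponential points; e.g.
`{x₁ = x₀³, x₀ y₀² = x₀ + 1}`, a member of gen 18's residual equimodular class of `y₀`-degree `2`
(`Re(lc·i³) = 0`, `3·Re(lc·i²)·log|θ| + Re(p₂ i²) = -3 log 1 + 0 = 0` for both roots `θ = ±1`).
An OPEN question in general (PLMS 2024 §1 p. 5); EC(3,2) OPEN; NOT Schanuel's conjecture.
-/

noncomputable section

open Complex MvPolynomial
open Literature.NumberTheory.Transcendental Literature.ModelTheory.Zilber
open Literature.ModelTheory.ExponentialFields

set_option linter.dupNamespace false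

namespace Summit.Schanuel.Schanuel.Theorems

/-- `P = x₀ y₀^r - x₀ - 1` evaluates as `x·y^r + (-x - 1)`. -/
theorem eval_binomialP (r : ℕ) (x y : ℂ) :
    MvPolynomial.eval ![x, y] (X 0 * X 1 ^ r - X 0 - 1 : MvPolynomial (Fin 2) ℂ) =
      (Polynomial.X : Polynomial ℂ).eval x * y ^ r + (-Polynomial.X - 1 : Polynomial ℂ).eval x := by
  simp; ring

/-- `x₀ y₀^r - x₀ - 1` is irreducible for `r ≥ 1` (degree one in `x₀` over `ℂ[y₀]`, with coefficients
`y₀^r - 1 ≠ 0` and the unit `-1`). -/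
theorem irreducible_binomialP {r : ℕ} (hr : 1 ≤ r) :
    Irreducible (X 0 * X 1 ^ r - X 0 - 1 : MvPolynomial (Fin 2) ℂ) := by
  have himage : MvPolynomial.finSuccEquiv ℂ 1 (X 0 * X 1 ^ r - X 0 - 1) =
      Polynomial.C (X 0 ^ r - 1 : MvPolynomial (Fin 1) ℂ) * Polynomial.X + Polynomial.C (-1) := by
    rw [map_sub, map_sub, map_mul, map_pow, map_one, MvPolynomial.finSuccEquiv_X_zero,
      show (X 1 : MvPolynomial (Fin 2) ℂ) = X (Fin.succ 0) from rfl, MvPolynomial.finSuccEquiv_X_succ,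
      map_sub, map_pow, map_one, map_neg, map_one]
    ring
  have ha : (X 0 ^ r - 1 : MvPolynomial (Fin 1) ℂ) ≠ 0 := by
    intro h
    have := congrArg (MvPolynomial.eval fun _ => (2 : ℂ)) h
    simp only [map_sub, map_pow, MvPolynomial.eval_X, map_one, map_zero] at this
    have h2 : (2 : ℂ) ^ r = 1 := sub_eq_zero.1 this
    have h3 : (2 : ℝ) ^ r = 1 := by exact_mod_cast h2
    have h4 : (1 : ℝ) < 2 ^ r := one_lt_pow₀ (by norm_num) (by omega)
    linarith
  have hirr := irreducible_C_mul_X_add_C_of_isUnit (R := MvPolynomial (Fin 1) ℂ) ha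
    (isUnit_one.neg)
  rw [← himage] at hirr
  exact (MulEquiv.irreducible_iff (MvPolynomial.finSuccEquiv ℂ 1).toMulEquiv).1 hirr

/-- **`{x₁ = c·x₀^d, x₀ y₀^r = x₀ + 1}` is in Mantova–Masser's case and DENSE** for all `d ≥ 2`,
`r ≥ 1`, `c ≠ 0`: `e^{x₁} = exp(c·x₀^d)` where `e^{r x₀} = 1 + 1/x₀`.
[cite: MantovaMasser2023, §1 Further remarks, p. 5 (the question, open in general)] (new) -/
theorem unprojectedDensityQuestion_monomialGraph_binomialFibre {c : ℂ} (hc : c ≠ 0) {d : ℕ}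
    (hd : 2 ≤ d) {r : ℕ} (hr : 1 ≤ r) :
    MMCaseDimPiOneFree {w : Fin 2 ⊕ Fin 2 → ℂ |
      w (Sum.inl 1) = c * w (Sum.inl 0) ^ d ∧
        w (Sum.inl 0) * w (Sum.inr 0) ^ r - w (Sum.inl 0) - 1 = 0} ∧
    UnprojectedDense {w : Fin 2 ⊕ Fin 2 → ℂ |
      w (Sum.inl 1) = c * w (Sum.inl 0) ^ d ∧
        w (Sum.inl 0) * w (Sum.inr 0) ^ r - w (Sum.inl 0) - 1 = 0} := by
  have hset : {w : Fin 2 ⊕ Fin 2 → ℂ |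
      w (Sum.inl 1) = c * w (Sum.inl 0) ^ d ∧
        w (Sum.inl 0) * w (Sum.inr 0) ^ r - w (Sum.inl 0) - 1 = 0} =
      {w : Fin 2 ⊕ Fin 2 → ℂ |
        w (Sum.inl 1) = (Polynomial.C c * Polynomial.X ^ d).eval (w (Sum.inl 0)) ∧
        MvPolynomial.eval ![w (Sum.inl 0), w (Sum.inr 0)]
          (X 0 * X 1 ^ r - X 0 - 1 : MvPolynomial (Fin 2) ℂ) = 0} := by
    ext w
    simp only [Set.mem_setOf_eq, Polynomial.eval_mul, Polynomial.eval_C, Polynomial.eval_pow,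
      Polynomial.eval_X, MvPolynomial.eval_X, map_sub, map_mul, map_pow, map_one,
      Matrix.cons_val_zero, Matrix.cons_val_one]
  rw [hset]
  refine unprojectedDensityQuestion_graphBinomialSurface Polynomial.X (-Polynomial.X - 1) hr
    (eval_binomialP r) (irreducible_binomialP hr) (by simp) ?_ ?_ _ ?_ 0 ?_
  · rw [Polynomial.natDegree_X, show (-Polynomial.X - 1 : Polynomial ℂ) = -(Polynomial.X + Polynomial.C 1)
      by rw [map_one]; ring, Polynomial.natDegree_neg, Polynomial.natDegree_X_add_C]
  · exact ⟨-1, -1, by ring⟩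
  · rwa [Polynomial.natDegree_C_mul_X_pow d c hc]
  · rw [show (-Polynomial.X - 1 : Polynomial ℂ) = -(Polynomial.X + Polynomial.C 1) by rw [map_one]; ring,
      Polynomial.leadingCoeff_neg, Polynomial.leadingCoeff_X_add_C, Polynomial.leadingCoeff_X,
      Complex.exp_zero]
    ring

/-- **`{x₁ = x₀³, x₀ y₀² = x₀ + 1}` has Zariski-dense exponential points** — an equimodular member of
`y₀`-degree `2` over a cubic base (both square roots `y₀ = ±(1 + 1/x₀)^{1/2}` are reached by the single
label family `x₀ = πik + ½ log(1 + 1/x₀)`).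
[cite: MantovaMasser2023, §1 Further remarks, p. 5 (the question, open in general)] (new) -/
theorem unprojectedDense_cubicGraph_sqrtFibre :
    UnprojectedDense {w : Fin 2 ⊕ Fin 2 → ℂ |
      w (Sum.inl 1) = w (Sum.inl 0) ^ 3 ∧ w (Sum.inl 0) * w (Sum.inr 0) ^ 2 - w (Sum.inl 0) - 1 = 0} := by
  have h := (unprojectedDensityQuestion_monomialGraph_binomialFibre one_ne_zero (by norm_num : 2 ≤ 3)
    (by norm_num : 1 ≤ 2)).2
  simpa only [one_mul] using h

end Summit.Schanuel.Schanuel.Theorems
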